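import Mathlib
import Summits.Ventures.PercRepro2.Defs
import Summits.Ventures.PercRepro2.Independence
import Summits.Ventures.PercRepro2.Harris
import Summits.Ventures.PercRepro2.ThreeEventSafe
import Summits.Ventures.PercRepro2.ThreeEventCross
import Summits.Ventures.PercRepro2.ThreeEventCertificate
import Summits.Ventures.PercRepro2.ThreeEventCertificateSwap
import Summits.Ventures.PercRepro2.ThreeEventCertificateInduction
import Summits.Ventures.PercRepro2.ThreeEventAD
import Summits.Ventures.PercRepro2.ThreeEventCertificateAD
import Summits.Ventures.PercRepro2.ThreeEventCertificateSections

/-!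
# The certificate induction BY SECTIONS with FINITE SUMS of certificate terms (blind cell PercRepro2,
p4 g34; proofs/P4-G34-SECTIONS.md §6)

The section-form certificate induction of ThreeEventCertificateSections with an ARBITRARY finite
nonnegative combination of certificate terms: `k` symmetrised pair weights of quadruples of the class
`P` (coefficients `l i ≥ 0`) and `m` symmetrised Ahlswede–Daykin terms
`1_{D j}(ω) 1_{C j}(ω') − 1_{X j}(ω) 1_{Y j}(ω')` (meets of `X j × Y j` in `C j`, joins in `D j`;
coefficients `μ j ≥ 0`), required pointwise on the support `InSupport p` of the weight vector with the
edge `e` open. This is exactly the shape of the certificates the censuses produce (an LP over a family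
of admissible instances and AD terms); the two-plus-two forms of ThreeEventCertificateInduction /
ThreeEventCertificateAD are the cases `k = m = 2` on the whole cube.
**`cov_inter_le_cov_of_certificates_sec`**: the three-event lemma `Cov(M, B ∩ H) ≤ Cov(G, H)` for all
admissible quadruples MODULO the section form (∃-CERT-sec): every admissible quadruple, restricted to
every section of the cube, has an unpinned edge with such a certificate on that section.
No definition, no instance, no notation.
-/

namespace Summit.Ventures.PercRepro2

namespace ThreeEvent

section Sums

variable {E : Type*} [Fintype E] [DecidableEq E] {R : Type*} [CommRing R]

/-- A double sum of weights against a finite combination of pair functions is the combination of the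
double sums. -/
lemma double_sum_mul_sum_eq {k : ℕ} (w : Config E → R) (l : Fin k → R)
    (f : Fin k → Config E → Config E → R) :
    ∑ ω, ∑ ω', w ω * w ω' * (∑ i, l i * f i ω ω')
      = ∑ i, l i * ∑ ω, ∑ ω', w ω * w ω' * f i ω ω' := by
  calc ∑ ω, ∑ ω', w ω * w ω' * (∑ i, l i * f i ω ω')
      = ∑ ω, ∑ ω', ∑ i, l i * (w ω * w ω' * f i ω ω') := by
        refine Finset.sum_congr rfl fun ω _ => Finset.sum_congr rfl fun ω' _ => ?_
        rw [Finset.mul_sum]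
        refine Finset.sum_congr rfl fun i _ => ?_
        ring
    _ = ∑ ω, ∑ i, ∑ ω', l i * (w ω * w ω' * f i ω ω') := by
        refine Finset.sum_congr rfl fun ω _ => ?_
        exact Finset.sum_comm
    _ = ∑ i, ∑ ω, ∑ ω', l i * (w ω * w ω' * f i ω ω') := Finset.sum_comm
    _ = ∑ i, l i * ∑ ω, ∑ ω', w ω * w ω' * f i ω ω' := by
        refine Finset.sum_congr rfl fun i _ => ?_
        rw [Finset.mul_sum]
        refine Finset.sum_congr rfl fun ω _ => ?_
        rw [Finset.mul_sum]

/-- Splitting a double sum against a sum of two pair functions. -/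
lemma double_sum_mul_add_eq (w : Config E → R) (f g : Config E → Config E → R) :
    ∑ ω, ∑ ω', w ω * w ω' * (f ω ω' + g ω ω')
      = (∑ ω, ∑ ω', w ω * w ω' * f ω ω') + ∑ ω, ∑ ω', w ω * w ω' * g ω ω' := by
  rw [← Finset.sum_add_distrib]
  refine Finset.sum_congr rfl fun ω _ => ?_
  rw [← Finset.sum_add_distrib]
  refine Finset.sum_congr rfl fun ω' _ => ?_
  ring

end Sums

section Certificate

variable {E : Type*} [Fintype E] [DecidableEq E] {R : Type*} [CommRing R] [LinearOrder R]
  [IsStrictOrderedRing R]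

/-- **Symmetrised certificates from finite sums of pair weights and Ahlswede–Daykin terms, on the
support.** If, on the configurations of the support of `p` with `e` open,
`Σ_i l_i (c_i(ω,ω') + c_i(ω',ω)) + Σ_j μ_j (a_j(ω,ω') + a_j(ω',ω)) ≤ χ(ω,ω') + χ(ω',ω)` with
`μ_j ≥ 0` and each `a_j` an AD term, then `2 Σ_i l_i Ψ_{p[e↦1]}(i) ≤ 2 X_p(e)` (`e` unpinned). -/
theorem crossTerm_ge_of_pointwise_sum_sec {p : E → R} (hp : IsProbVec p) {e : E}
    (he : e ∈ unpinned p) (G H M B : Set (Config E)) {k m : ℕ}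
    (G₁ H₁ M₁ B₁ : Fin k → Set (Config E)) (l : Fin k → R)
    (X Y C D : Fin m → Set (Config E)) (μ : Fin m → R)
    (hAD : ∀ j, ∀ a ∈ X j, ∀ b ∈ Y j, a ⊓ b ∈ C j ∧ a ⊔ b ∈ D j) (hμ : ∀ j, 0 ≤ μ j)
    (hcert : ∀ ω ω' : Config E, InSupport p ω → InSupport p ω' → ω e = true → ω' e = true →
      (∑ i, l i * (pairWt (G₁ i) (H₁ i) (M₁ i) (B₁ i) ω ω' + pairWt (G₁ i) (H₁ i) (M₁ i) (B₁ i) ω' ω))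
        + (∑ j, μ j * (((D j).indicator (1 : Config E → R) ω * (C j).indicator 1 ω'
                          - (X j).indicator (1 : Config E → R) ω * (Y j).indicator 1 ω')
                        + ((D j).indicator (1 : Config E → R) ω' * (C j).indicator 1 ω
                          - (X j).indicator (1 : Config E → R) ω' * (Y j).indicator 1 ω)))
        ≤ (pairWt G H M B (Function.update ω e false) ω'
            + pairWt G H M B ω (Function.update ω' e false))
          + (pairWt G H M B (Function.update ω' e false) ω
            + pairWt G H M B ω' (Function.update ω e false))) :
    2 * (∑ i, l i * defect (Function.update p e 1) (G₁ i) (H₁ i) (M₁ i) (B₁ i))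
      ≤ 2 * crossTerm p e G H M B := by
  have hq : IsProbVec (Function.update p e 1) := hp.update e zero_le_one le_rfl
  -- the certificate summed against the weights of `p[e↦1]`, which vanish off the support
  have hsum : ∑ ω, ∑ ω', weight (Function.update p e 1) ω * weight (Function.update p e 1) ω'
        * ((∑ i, l i * (pairWt (G₁ i) (H₁ i) (M₁ i) (B₁ i) ω ω'
              + pairWt (G₁ i) (H₁ i) (M₁ i) (B₁ i) ω' ω))
          + (∑ j, μ j * (((D j).indicator (1 : Config E → R) ω * (C j).indicator 1 ω'
                            - (X j).indicator (1 : Config E → R) ω * (Y j).indicator 1 ω')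
                          + ((D j).indicator (1 : Config E → R) ω' * (C j).indicator 1 ω
                            - (X j).indicator (1 : Config E → R) ω' * (Y j).indicator 1 ω))))
      ≤ ∑ ω, ∑ ω', weight (Function.update p e 1) ω * weight (Function.update p e 1) ω'
          * ((pairWt G H M B (Function.update ω e false) ω'
              + pairWt G H M B ω (Function.update ω' e false))
            + (pairWt G H M B (Function.update ω' e false) ω
              + pairWt G H M B ω' (Function.update ω e false))) := by
    refine Finset.sum_le_sum fun ω _ => Finset.sum_le_sum fun ω' _ => ?_
    have hw : 0 ≤ weight (Function.update p e 1) ω * weight (Function.update p e 1) ω' :=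
      mul_nonneg (weight_nonneg hq ω) (weight_nonneg hq ω')
    by_cases hs : InSupport (Function.update p e 1) ω
    · by_cases hs' : InSupport (Function.update p e 1) ω'
      · obtain ⟨h1, he1⟩ := inSupport_of_inSupport_update_one he hs
        obtain ⟨h2, he2⟩ := inSupport_of_inSupport_update_one he hs'
        exact mul_le_mul_of_nonneg_left (hcert ω ω' h1 h2 he1 he2) hw
      · rw [weight_eq_zero_of_not_inSupport _ hs']
        simp
    · rw [weight_eq_zero_of_not_inSupport _ hs]
      simp
  rw [double_sum_mul_add_eq, double_sum_mul_sum_eq, double_sum_mul_sum_eq] at hsum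
  -- the AD double sums are nonnegative
  have hADsum : 0 ≤ ∑ j, μ j * ∑ ω, ∑ ω', weight (Function.update p e 1) ω
      * weight (Function.update p e 1) ω'
      * (((D j).indicator (1 : Config E → R) ω * (C j).indicator 1 ω'
            - (X j).indicator (1 : Config E → R) ω * (Y j).indicator 1 ω')
          + ((D j).indicator (1 : Config E → R) ω' * (C j).indicator 1 ω
            - (X j).indicator (1 : Config E → R) ω' * (Y j).indicator 1 ω)) :=
    Finset.sum_nonneg fun j _ => mul_nonneg (hμ j) (ad_double_sum_sym_nonneg hq (hAD j))
  -- the pair-weight double sums are the doubled defects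
  have hdef : ∑ i, l i * ∑ ω, ∑ ω', weight (Function.update p e 1) ω
      * weight (Function.update p e 1) ω'
      * (pairWt (G₁ i) (H₁ i) (M₁ i) (B₁ i) ω ω' + pairWt (G₁ i) (H₁ i) (M₁ i) (B₁ i) ω' ω)
      = 2 * ∑ i, l i * defect (Function.update p e 1) (G₁ i) (H₁ i) (M₁ i) (B₁ i) := by
    rw [Finset.mul_sum]
    refine Finset.sum_congr rfl fun i _ => ?_
    rw [← two_mul_defect_eq']
    ring
  rw [hdef, ← two_mul_crossTerm_eq'] at hsum
  linarith

end Certificate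

section Induction

variable {E : Type*} [Fintype E] [DecidableEq E] {R : Type*} [CommRing R] [LinearOrder R]
  [IsStrictOrderedRing R]

/-- **The certificate induction by sections with finite sums.** Let `P` be any class of quadruples. If
every quadruple of the class, at every admissible weight vector `p` with an unpinned edge, has an
unpinned edge `e` and a finite nonnegative combination of symmetrised pair weights of quadruples of
the class and of symmetrised Ahlswede–Daykin terms bounded pointwise by the symmetrised cross pair
weight on the configurations OF THE SUPPORT OF `p` with `e` open, then the defect is nonnegative for
every quadruple of the class and every admissible `p`. -/
theorem defect_nonneg_of_certificates_sec
    (P : Set (Config E) → Set (Config E) → Set (Config E) → Set (Config E) → Prop)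
    (hcert : ∀ (G H M B : Set (Config E)), P G H M B →
      ∀ p : E → R, IsProbVec p → (unpinned p).Nonempty →
        ∃ e ∈ unpinned p, ∃ (k m : ℕ) (G₁ H₁ M₁ B₁ : Fin k → Set (Config E)) (l : Fin k → R)
          (X Y C D : Fin m → Set (Config E)) (μ : Fin m → R),
          (∀ i, P (G₁ i) (H₁ i) (M₁ i) (B₁ i)) ∧ (∀ i, 0 ≤ l i) ∧ (∀ j, 0 ≤ μ j) ∧
          (∀ j, ∀ a ∈ X j, ∀ b ∈ Y j, a ⊓ b ∈ C j ∧ a ⊔ b ∈ D j) ∧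
          ∀ ω ω' : Config E, InSupport p ω → InSupport p ω' → ω e = true → ω' e = true →
            (∑ i, l i * (pairWt (G₁ i) (H₁ i) (M₁ i) (B₁ i) ω ω'
                + pairWt (G₁ i) (H₁ i) (M₁ i) (B₁ i) ω' ω))
              + (∑ j, μ j * (((D j).indicator (1 : Config E → R) ω * (C j).indicator 1 ω'
                                - (X j).indicator (1 : Config E → R) ω * (Y j).indicator 1 ω')
                              + ((D j).indicator (1 : Config E → R) ω' * (C j).indicator 1 ω
                                - (X j).indicator (1 : Config E → R) ω' * (Y j).indicator 1 ω)))
              ≤ (pairWt G H M B (Function.update ω e false) ω'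
                  + pairWt G H M B ω (Function.update ω' e false))
                + (pairWt G H M B (Function.update ω' e false) ω
                  + pairWt G H M B ω' (Function.update ω e false))) :
    ∀ (G H M B : Set (Config E)), P G H M B → ∀ p : E → R, IsProbVec p →
      0 ≤ defect p G H M B := by
  classical
  suffices key : ∀ (n : ℕ) (p : E → R), IsProbVec p → (unpinned p).card = n →
      ∀ (G H M B : Set (Config E)), P G H M B → 0 ≤ defect p G H M B by
    intro G H M B hP p hp
    exact key _ p hp rfl G H M B hP
  intro n
  induction n using Nat.strong_induction_on with
  | _ n ih =>
    intro p hp hn G H M B hP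
    by_cases hne : (unpinned p).Nonempty
    · obtain ⟨e, he, k, m, G₁, H₁, M₁, B₁, l, X, Y, C, D, μ, hP₁, hl, hμ, hAD, hpt⟩ :=
        hcert G H M B hP p hp hne
      have ha0 : 0 ≤ p e := hp.nonneg e
      have ha1 : 0 ≤ 1 - p e := sub_nonneg.2 (hp.le_one e)
      have hcard : ((unpinned p).erase e).card < n := by
        rw [← hn]; exact Finset.card_erase_lt_of_mem he
      have hp1 : IsProbVec (Function.update p e 1) := hp.update e zero_le_one le_rfl
      have hp0 : IsProbVec (Function.update p e 0) := hp.update e le_rfl zero_le_one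
      have hc1 : (unpinned (Function.update p e 1)).card = ((unpinned p).erase e).card := by
        rw [unpinned_update p he 1 (Or.inr rfl)]
      have hc0 : (unpinned (Function.update p e 0)).card = ((unpinned p).erase e).card := by
        rw [unpinned_update p he 0 (Or.inl rfl)]
      have h1 : 0 ≤ defect (Function.update p e 1) G H M B := ih _ hcard _ hp1 hc1 G H M B hP
      have h0 : 0 ≤ defect (Function.update p e 0) G H M B := ih _ hcard _ hp0 hc0 G H M B hP
      have hJ : 0 ≤ ∑ i, l i * defect (Function.update p e 1) (G₁ i) (H₁ i) (M₁ i) (B₁ i) :=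
        Finset.sum_nonneg fun i _ =>
          mul_nonneg (hl i) (ih _ hcard _ hp1 hc1 (G₁ i) (H₁ i) (M₁ i) (B₁ i) (hP₁ i))
      have hX2 := crossTerm_ge_of_pointwise_sum_sec hp he G H M B G₁ H₁ M₁ B₁ l X Y C D μ hAD hμ
        hpt
      have hX : 0 ≤ crossTerm p e G H M B := by linarith
      rw [defect_eq_pin_cross p G H M B e]
      have := mul_nonneg (mul_nonneg ha0 ha1) hX
      have := mul_nonneg (pow_nonneg ha0 2) h1
      have := mul_nonneg (pow_nonneg ha1 2) h0
      linarith
    · have hpin : ∀ e, p e = 0 ∨ p e = 1 := fun e => by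
        by_contra hcon
        refine hne ⟨e, ?_⟩
        simp only [unpinned, Finset.mem_filter, Finset.mem_univ, true_and]
        exact ⟨fun h => hcon (Or.inl h), fun h => hcon (Or.inr h)⟩
      rw [defect_eq_zero_of_pinned p hpin]

/-- **The three-event lemma modulo (∃-CERT-sec)**: for the class of admissible quadruples (increasing
`G ⊇ M ⊇ G ∩ B`, increasing `H`, decreasing `B`), the section form of the finite-sum certificate
hypothesis gives `Cov_p(M, B ∩ H) ≤ Cov_p(G, H)` for every admissible quadruple and weight vector. -/
theorem cov_inter_le_cov_of_certificates_sec
    (hcert : ∀ (G H M B : Set (Config E)),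
      (IsUpperSet G ∧ IsUpperSet H ∧ IsUpperSet M ∧ IsLowerSet B ∧ M ⊆ G ∧ G ∩ B ⊆ M) →
      ∀ p : E → R, IsProbVec p → (unpinned p).Nonempty →
        ∃ e ∈ unpinned p, ∃ (k m : ℕ) (G₁ H₁ M₁ B₁ : Fin k → Set (Config E)) (l : Fin k → R)
          (X Y C D : Fin m → Set (Config E)) (μ : Fin m → R),
          (∀ i, IsUpperSet (G₁ i) ∧ IsUpperSet (H₁ i) ∧ IsUpperSet (M₁ i) ∧ IsLowerSet (B₁ i)
            ∧ M₁ i ⊆ G₁ i ∧ G₁ i ∩ B₁ i ⊆ M₁ i) ∧ (∀ i, 0 ≤ l i) ∧ (∀ j, 0 ≤ μ j) ∧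
          (∀ j, ∀ a ∈ X j, ∀ b ∈ Y j, a ⊓ b ∈ C j ∧ a ⊔ b ∈ D j) ∧
          ∀ ω ω' : Config E, InSupport p ω → InSupport p ω' → ω e = true → ω' e = true →
            (∑ i, l i * (pairWt (G₁ i) (H₁ i) (M₁ i) (B₁ i) ω ω'
                + pairWt (G₁ i) (H₁ i) (M₁ i) (B₁ i) ω' ω))
              + (∑ j, μ j * (((D j).indicator (1 : Config E → R) ω * (C j).indicator 1 ω'
                                - (X j).indicator (1 : Config E → R) ω * (Y j).indicator 1 ω')
                              + ((D j).indicator (1 : Config E → R) ω' * (C j).indicator 1 ω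
                                - (X j).indicator (1 : Config E → R) ω' * (Y j).indicator 1 ω)))
              ≤ (pairWt G H M B (Function.update ω e false) ω'
                  + pairWt G H M B ω (Function.update ω' e false))
                + (pairWt G H M B (Function.update ω' e false) ω
                  + pairWt G H M B ω' (Function.update ω e false)))
    {G H M B : Set (Config E)} (hG : IsUpperSet G) (hH : IsUpperSet H) (hM : IsUpperSet M)
    (hB : IsLowerSet B) (hMG : M ⊆ G) (hGB : G ∩ B ⊆ M) {p : E → R} (hp : IsProbVec p) :
    prob p (M ∩ (B ∩ H)) - prob p M * prob p (B ∩ H) ≤ prob p (G ∩ H) - prob p G * prob p H :=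
  sub_nonneg.1 (defect_nonneg_of_certificates_sec
    (fun G H M B => IsUpperSet G ∧ IsUpperSet H ∧ IsUpperSet M ∧ IsLowerSet B ∧ M ⊆ G ∧ G ∩ B ⊆ M)
    hcert G H M B ⟨hG, hH, hM, hB, hMG, hGB⟩ p hp)

end Induction

end ThreeEvent

end Summit.Ventures.PercRepro2
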